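import Summits.NavierStokesRegularity.NavierStokesRegularity.Theorems.TypeILiouvilleTypeIliouvilleNoTypeIIEternalEnergyLiouvilleCore3D
import Summits.NavierStokesRegularity.NavierStokesRegularity.Theorems.TypeILiouvilleTypeIliouvilleNoTypeIIEternalEnergyLiouvilleAxisymSwirl
import Summits.NavierStokesRegularity.NavierStokesRegularity.Theorems.TypeILiouvilleTypeIliouvilleNoTypeIIEternalEnergyLiouvilleL3Slices
import HarnessLib

/-!
# EEL′ reduces to its residual core — all settled strata removed (crux `TypeIliouvilleNoTypeII`,
# stmt-NavierStokesRegularity-0056; rigidity residual EEL′ of the pressure-free eternal split)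

Helper file (theorems only) — the capstone `eternalLiouvillePressureFree_of_core3D` (p486617) refined by
the two further unconditional strata `axisym_C_over_r_eq_zero` (KNSS Thm 5.3, p486980) and
`eq_zero_of_L3_slices_atBot` (Albritton–Barker Thm 1.2, p487163).  The pressure-free eternal energy
Liouville statement EEL′ (the `hEEL` binder of p456438, under which `S₁_unit ↔ NoTypeII`) follows from
its restriction to the members `W` of the class that are

  (i) EXTREMAL (`‖W‖ ≤ ‖W(0,0)‖`); (ii) NOT time-independent; (iii) NOT time-periodic;
  (iv) NOT axisymmetric-without-swirl; (v) NOT discretely self-similar;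
  (vi) WITHOUT a translation-invariant direction; (vii) NOT axisymmetric with KNSS's bound
  `cylRadius · ‖W‖ ≤ C`; (viii) `L³`-DIVERGENT at `-∞` (no sequence `τ_k → -∞` with
  `‖W(τ_k)‖₃` bounded).

* `eternalLiouvillePressureFree_of_residualCore` — **EEL′ ⟸ EEL′_residual**, both in the `hEEL` shape.

WHAT THIS IS NOT: not NS; EEL′_residual is OPEN — a Liouville theorem for transient, genuinely
three-dimensional, swirling-or-non-axisymmetric, non-self-similar, `L³`-divergent, extremal eternal
profiles in the energy class `A_ess, C, E ≤ I`. [folklore]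
-/

noncomputable section

-- the summit and its single problem share the name `NavierStokesRegularity` (D-0017 nested layout)
set_option linter.dupNamespace false

open Set Function Filter Topology MeasureTheory Metric
open scoped NNReal ENNReal

namespace Summit.NavierStokesRegularity.NavierStokesRegularity.Theorems.TypeIliouvilleNoTypeII.TypeIIZoom

open Literature.Analysis Literature.Analysis.FluidPDE

/-- **EEL′ follows from EEL′ on the residual core** (eight settled strata removed; see the module
docstring). [cite: KochNadirashviliSereginSverak2009, Thms 5.1–5.3, Lemma 6.1 (arXiv:0709.3599 pp. 8–13)] [cite: AlbrittonBarker2019, Thm. 1.2 (arXiv:1811.00502 p. 4)] -/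
theorem eternalLiouvillePressureFree_of_residualCore
    (hcore : ∀ W : ℝ → EuclideanSpace ℝ (Fin 3) → EuclideanSpace ℝ (Fin 3),
      ContDiff ℝ (⊤ : ℕ∞) (uncurry W) → (∀ t, VectorCalculus.IsDivFree (W t)) →
      (∀ s t : ℝ, s < t → ∀ x, W t x = heatFlow (W s) (t - s) x - oseenDuhamel 1 s W W t x) →
      (∀ t x, ‖W t x‖ ≤ ‖W 0 0‖) →
      (∃ I : ℝ≥0∞, I ≠ ⊤ ∧ ∀ r : ℝ, 0 < r → ∀ z : ℝ × EuclideanSpace ℝ (Fin 3),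
        cknAEss r z W ≤ I ∧ cknC r z W ≤ I ∧ cknE r z (fun s y => fderiv ℝ (W s) y) ≤ I) →
      ¬ (∀ (t : ℝ) (y : EuclideanSpace ℝ (Fin 3)), W t y = W 0 y) →
      ¬ (∃ P : ℝ, 0 < P ∧ ∀ (t : ℝ) (x : EuclideanSpace ℝ (Fin 3)), W (t + P) x = W t x) →
      ¬ ((∀ t, IsAxisymmetric (W t)) ∧ ∀ t, HasNoSwirl (W t)) →
      ¬ (∃ μ : ℝ, 1 < μ ∧ ∀ (s : ℝ) (y : EuclideanSpace ℝ (Fin 3)), W s y = μ • W (μ ^ 2 * s) (μ • y)) →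
      ¬ (∃ e : EuclideanSpace ℝ (Fin 3), e ≠ 0 ∧
          ∀ (t : ℝ) (x : EuclideanSpace ℝ (Fin 3)) (δ : ℝ), W t (x + δ • e) = W t x) →
      ¬ ((∀ t, IsAxisymmetric (W t)) ∧
          ∃ C : ℝ, ∀ (t : ℝ) (x : EuclideanSpace ℝ (Fin 3)), cylRadius x * ‖W t x‖ ≤ C) →
      ¬ (∃ (τ : ℕ → ℝ) (M : ℝ≥0∞), M < ⊤ ∧ Tendsto τ atTop atBot ∧
          ∀ k, eLpNorm (W (τ k)) 3 volume ≤ M) →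
      W 0 0 = 0)
    (v : ℝ → EuclideanSpace ℝ (Fin 3) → EuclideanSpace ℝ (Fin 3))
    (hv : ContDiff ℝ (⊤ : ℕ∞) (uncurry v)) (hdiv : ∀ t, VectorCalculus.IsDivFree (v t))
    (hmild : ∀ s t : ℝ, s < t → ∀ x, v t x = heatFlow (v s) (t - s) x - oseenDuhamel 1 s v v t x)
    (hbd : ∀ (t : ℝ) (x : EuclideanSpace ℝ (Fin 3)), ‖v t x‖ ≤ 2)
    (hI : ∃ I : ℝ≥0∞, I ≠ ⊤ ∧ ∀ r : ℝ, 0 < r → ∀ z : ℝ × EuclideanSpace ℝ (Fin 3),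
      cknAEss r z v ≤ I ∧ cknC r z v ≤ I ∧ cknE r z (fun s y => fderiv ℝ (v s) y) ≤ I) :
    v 0 0 = 0 := by
  refine eternalLiouvillePressureFree_of_core3D ?_ v hv hdiv hmild hbd hI
  intro W hW hWdiv hWmild hWsup hWI hsteady hper haxi hdss hline
  by_cases hswirl : (∀ t, IsAxisymmetric (W t)) ∧
      ∃ C : ℝ, ∀ (t : ℝ) (x : EuclideanSpace ℝ (Fin 3)), cylRadius x * ‖W t x‖ ≤ C
  · exact axisym_C_over_r_eq_zero hW hWdiv hWmild ⟨‖W 0 0‖, hWsup⟩ hswirl.1 hswirl.2 0 0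
  by_cases hL3 : ∃ (τ : ℕ → ℝ) (M : ℝ≥0∞), M < ⊤ ∧ Tendsto τ atTop atBot ∧
      ∀ k, eLpNorm (W (τ k)) 3 volume ≤ M
  · exact eq_zero_of_L3_slices_atBot hW hWdiv hWmild ⟨‖W 0 0‖, hWsup⟩ hL3 0 0
  exact hcore W hW hWdiv hWmild hWsup hWI hsteady hper haxi hdss hline hswirl hL3

end Summit.NavierStokesRegularity.NavierStokesRegularity.Theorems.TypeIliouvilleNoTypeII.TypeIIZoom

end
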